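/-
COR-CM (cell pub-hodgecm2, stage 2 of the Hodge ladder) — Δ2 BRIDGE, WALL-BREAKER 3 («CONJUGATE REST AT δ′»; coordinator ruling on
ASSEMBLER DECISION #13, pub-hodgecm2/INBOX l.11382; DECISION #14 l.11421; ORIENTATION-MEMO v1.2): THE CONJUGATE-PRESENTED SHARED TAIL.
Seat prover-pub-hodgecm2-d2bridge-wb-3-g0-0.  THEOREMS ONLY (kernel lane): no definition, no named fact, no instance, no section `variable`
carrying a named Prop, no `sorry`; every landed file untouched; OUTSIDE the frozen port manifest (blanket `CorCM/D2Bridge/*`).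
FRAMING: HC_CM is NOT proved; «Δ2 BRIDGE CLOSED» is NOT claimed; hLiu = «[Liu21] Thm 4.18 at the constructed objects AS A READING (r8)»;
nothing here is a display, a pointer move or a count change.  BRANCH SERVED (DECISION #14 §2 (d)): T-ῑ (ORIENTATION-MEMO §3.3 ∕ §5).
-/
import Summits.HodgeConjecture.CorCM.D2Bridge.HcmPiecesAtTower
import Summits.HodgeConjecture.CorCM.D2Bridge.HcmS1LiuCMRecord
import Summits.HodgeConjecture.CorCM.D2Bridge.HcmS1PinAdm
import Literature.NumberTheory.Automorphic.Liu2021.AppendixC.Prop413DataOfRestOne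
import Literature.NumberTheory.Automorphic.Liu2021.Def45RMuFormSupply
import Literature.NumberTheory.Automorphic.Liu2021.Def45EtaConjugate
import HarnessLib

/-!
# Δ2 bridge — the (d) pieces at the SHARED tail under the GEOMETRIC-PIN instance: tail-free Weil side, `𝒜(μ) ≠ ∅` at any presentation, S1 through `η_μ`-invariance

[Liu2021] Y. Liu, *Fourier–Jacobi cycles and arithmetic relative trace formula*, Camb. J. Math. **9** (2021) = arXiv:2102.11518
(`l. NNNN` = lines of the author's TeX `FJcycle.tex`).

## What this file is (ORIENTATION-MEMO v1.3 §3.3 «T-ῑ» ∕ realisation (c-S.1): the dictionary re-keyed at the geometric pin `ῑ₁`)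

The pin signatures type every per-line binder over ONE rest `(U i hμ hg).rest (tail i hμ hg)` whose tail of record is the `ι₁`-PRESENTED
one-object tail `restTailOne (AlgHom.id ℚ L) ι₁ hμ hw Car (T.rhoΩOne …)` ([Liu2021] Def. 4.5 (2) typed through `ι₁`), while the tree's surfaces
sit in `X_K ⊗_{E,ῑ₁} ℂ` (✔ `AlbaneseOnPieceCofan`), so the J-record ∕ pieces chain composes BY VALUE only at the instance `algebraMap L ℂ = ῑ₁`, and
the landed S1 junction (✔ `exists_dLiu_of_objOne`) reads the datum through the instance embedding.  This file closes that seam WITHOUT a second tail: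
* §1 the Weil side of `U.rest t` is TAIL-INDEPENDENT (`rfl`: `AdmIndex`, `omegaAt`, `rhoAt`; `hnvD` transfer `nontrivial_omegaAt_rest_of_tail`);
* §2 `𝒜(μ) ≠ ∅` at ANY presentation `σ` from the one cite `h21` ([Shimura1998] Thm. 21.4; ✔ `Def45.nonempty_cmDatum_polDR_rMuForm_of_casselman`);
* §3 the pieces (d) with S1 DISCHARGED, rest PRESENTED through `ιP`, `A_μ` complexified along the INSTANCE `ιQ`, under the `η_μ`-invariance
  `Def45.eta id ιQ hμ = Def45.eta id ιP hμ` (READING I1-R1 of `Def45AsPrinted`; for `ιQ = conj ∘ ιP` the tree theorem ✔ `Def45.eta_starRingEnd_comp`):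
  the chosen datum `datum (AlgHom.id ℚ L) ιP … M.Dμ` is transported FIELD BY FIELD (same `A_μ`, same `i_μ`) to a `Def45.CMDatum (AlgHom.id ℚ L) ιQ …`
  inside the proof and ✔ `exists_liuCMRecord_of_cmDatum ιQ` is applied to it — `nonempty_hcmPieces_ofTower_of_cmDatum_at` (at `ιQ = ιP`: ✔ prove-8's
  `nonempty_hcmPieces_ofTower_of_cmDatum`), `…_of_isReflexOfTypeG_at` (admissibility as ONE implication `∀ d, d.IsReflexOfTypeG ιQ Φ' → adm i d`,
  ✔ `admLiu_mk_of_eq ιQ`), and §3′ `nonempty_hcmPieces_ofTower_rest_conj_of_isReflexOfTypeG`: the SHARED `ιP`-presented tail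
  `U.rest (restTailOne (AlgHom.id ℚ L) ιP …)`, instance `conj ∘ ιP`, `heta` discharged — the (d) value of the re-keyed composition modulo the
  J-side junction inputs (`rj hj jf hrj`, d2bridge-prove-2 ∕ -5), exactly as in prove-8's theorem.
NOT supplied (it is FALSE at `PhiMu` lines, ORIENTATION-MEMO §1): `d.IsReflexOfTypeG ῑ₁ Φ_{μ_i} → d.IsReflexOfTypeG ι₁ Φ_{μ_i}`; at the LITERAL
pin (`adm` keyed `ι₁`) no (d) value exists by this route.  Nothing about Liu's objects is asserted.  HC_CM is NOT proved; «Δ2 BRIDGE CLOSED» is NOT claimed.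

## References
* [Liu2021] Def. 4.5 (2) (l. 1944–1951), Prop. 4.6 (1) (l. 1969), Def. 4.11 ∕ 4.12 (l. 2083–2108), Def. 4.16 ∕ Rem. 4.17 (l. 2215–2228),
  Thm. 4.18 with proof (l. 2232–2253), Lem. 2.4 (1).
* [Shimura1998] G. Shimura, *Abelian Varieties with Complex Multiplication and Modular Functions* (1998), §21.4 Thm. 21.4; §7.1 Prop. 7, §8.3 Prop. 28.
-/

set_option autoImplicit false

noncomputable section

open scoped TensorProduct

namespace Summit.HodgeConjecture.CorCM.D2Bridge

open CategoryTheory NumberField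
open Literature.AlgebraicGeometry.Motives (SchemeOver AbelianVariety bettiCohomology)
open Literature.NumberTheory.ComplexMultiplication (shimura1998_thm21_4_casselman)
open Literature.AlgebraicGeometry.HodgeTheory
open Literature.AlgebraicGeometry.HodgeTheory.BettiUniverse (pull)
open Literature.AlgebraicGeometry.ShimuraVarieties.UnitaryCanonicalModel
open Literature.NumberTheory.Automorphic Literature.NumberTheory.Automorphic.PicardCM
open Literature.NumberTheory.Automorphic.Liu2021 Literature.NumberTheory.Automorphic.Liu2021.AppendixC
open Literature.NumberTheory.Automorphic.Liu2021.AppendixC.RestOne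
open Literature.NumberTheory.Transcendental (Arapura2012_Cor_15_4_6)
open HodgeCM.Model HodgeCM.Model.TowerCarrier
open HodgeCM.Literature.Theta.LiuAlbaneseModuleDatum.D2Bridge (HcmPieces)

/-! ## §1  The Weil side of `U.rest t` is tail-independent -/

section TailFree

variable {F E : Type} [Field F] [NumberField F] [IsTotallyReal F] [Field E] [NumberField E] [Algebra F E]
  [IsTotallyComplex E] [Algebra.IsQuadraticExtension F E]
variable {P5 : PropC5Data F E} {isotropicAt : ℕ → Prop} (C : Sec42Data P5 isotropicAt) (U : UniformOmega C)
variable {μ : Literature.NumberTheory.Automorphic.IdeleClassGroup E →ₜ* Circle}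
  {hμ : letI : IsCMField E := isCMField F E; IdeleClassGroup.IsConjugateSymplectic E μ} (t t' : RestTail C μ hμ)

/-- The index set `{(ε, χ) : ε μ-admissible}` of [Liu2021, Thm. 4.18] at the rest `U.rest t` does not depend on the tail `t`
(it reads only `Eps`, `Chi`, `epsOf`, `μ`, `Φ_μ`, all supplied by `U` and `μ`). [cite: Liu2021, Def. 4.12 (FJcycle.tex l. 2102–2108) and Thm. 4.18 (l. 2237)] -/
theorem admIndex_rest_eq_of_tail :
    (toThm418Data C (U.rest t)).AdmIndex = (toThm418Data C (U.rest t')).AdmIndex := rfl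

/-- `ω(μ, ε, χ)` at the rest `U.rest t` does not depend on the tail `t`. [cite: Liu2021, Def. 4.11 (FJcycle.tex l. 2092–2096)] -/
theorem omegaAt_rest_eq_of_tail (j : (toThm418Data C (U.rest t)).AdmIndex) :
    (toThm418Data C (U.rest t)).omegaAt j = (toThm418Data C (U.rest t')).omegaAt j := rfl

/-- The `𝔾(𝔸_F^∞)`-action on `ω(μ, ε, χ)` at the rest `U.rest t` does not depend on the tail `t`. [cite: Liu2021, Def. 4.11 (FJcycle.tex l. 2092–2096)] -/
theorem rhoAt_rest_eq_of_tail (j : (toThm418Data C (U.rest t)).AdmIndex) :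
    (toThm418Data C (U.rest t)).rhoAt j = (toThm418Data C (U.rest t')).rhoAt j := rfl

/-- **`hnvD` transfers between tails**: `ω(μ, ε, χ) ≠ 0` for every admissible index at `U.rest t` gives the same at `U.rest t'`.
[cite: Liu2021, Def. 4.11 (FJcycle.tex l. 2092–2096) and App. D Lemma D.1 (1) (l. 5229)] -/
theorem nontrivial_omegaAt_rest_of_tail
    (h : ∀ j : (toThm418Data C (U.rest t)).AdmIndex, Nontrivial ((toThm418Data C (U.rest t)).omegaAt j))
    (j : (toThm418Data C (U.rest t')).AdmIndex) : Nontrivial ((toThm418Data C (U.rest t')).omegaAt j) :=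
  h j

end TailFree

/-! ## §2  `𝒜(μ) ≠ ∅` at the one-object tail of ANY presentation -/

section ObjAlong

variable {hHD : exists_isReal_hodgeModel} {hI : hodgePQ_independent_of_hodgeModel}
  {h₁ : BallQuotientUniformised} {h₃ : CMAbelianVarietyRealised} {hA : Arapura2012_Cor_15_4_6}
variable {L : HodgeCM.CMField} {ι₁ : (L : Type) →+* ℂ} (V : HodgeCM.HermSpace3 L ι₁)
variable (Φ : Literature.AlgebraicGeometry.Motives.CMType L) {isotropicAt : ℕ → Prop}
variable {Lg : Type} [Field Lg] [NumberField Lg] [IsGalois ℚ Lg] (emb : (L : Type) →ₐ[ℚ] Lg) (ιg : Lg →+* ℂ)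
  {μ : Literature.NumberTheory.Automorphic.IdeleClassGroup (L : Type) →ₜ* Circle}
  (hμ : Literature.NumberTheory.Automorphic.IdeleClassGroup.IsConjugateSymplectic (L : Type) μ)
  (hw : Literature.NumberTheory.Automorphic.IdeleClassGroup.HasWeight (L : Type) μ 1) (Car : Def45.Carriers (L : Type) μ)

/-- At the one-object tail of presentation `(emb, ιg)` a consumer's `Nonempty Obj` IS [Liu2021, Prop. 4.6 (1)] «`𝒜(μ)` is nonempty» over the
honest object type `Def45.CMDatum emb ιg hμ hw Car` (✔ `nonempty_objOne_iff`, re-typed at `U.rest (restTailOne …)`).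
[cite: Liu2021, Prop. 4.6 (1) (FJcycle.tex l. 1966–1969)] -/
theorem nonempty_obj_rest_restTailOne_iff (h : exists_recordSystem)
    (C : Sec42Data (Model.honestP5Of h ⟨L.K⟩ ι₁ ⟨V.Hm, V.isHermitian, V.signature_ι₁, V.posDef_of_ne⟩ Φ) isotropicAt) (U : UniformOmega C)
    (rhoΩ : Representation (fieldOfValues (L : Type) μ) C.G (ΩOne C emb ιg hμ hw Car)) :
    Nonempty (toThm418Data C (U.rest (restTailOne emb ιg hμ hw Car rhoΩ))).Obj ↔ Nonempty (Def45.CMDatum emb ιg hμ hw Car) :=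
  nonempty_objOne_iff emb ιg hμ hw Car

/-- **`𝒜(μ) ≠ ∅` at the one-object tail of ANY presentation `σ : L → ℂ`** (in particular `σ := ῑ₁`), over the carrier with all four bullets of
Def. 4.5 (2) typed real, from the one cite `h21` = [Shimura1998] Thm. 21.4 (✔ `Def45.nonempty_cmDatum_polDR_rMuForm_of_casselman`, `σ`-generic).
[cite: Liu2021, Prop. 4.6 (1) (FJcycle.tex l. 1969) and its proof (l. 1975–1984)] [cite: Shimura1998, §21.4 Thm. 21.4] -/
theorem nonempty_obj_rest_restTailOne_of_casselman [IsGalois ℚ (L : Type)] (h : exists_recordSystem)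
    (C : Sec42Data (Model.honestP5Of h ⟨L.K⟩ ι₁ ⟨V.Hm, V.isHermitian, V.signature_ι₁, V.posDef_of_ne⟩ Φ) isotropicAt) (U : UniformOmega C)
    (σ : (L : Type) →+* ℂ)
    (rhoΩ : Representation (fieldOfValues (L : Type) μ) C.G
      (ΩOne C (AlgHom.id ℚ (L : Type)) σ hμ hw (Def45.Carriers.ofPolDR μ (Def45.PolDR σ hμ (Def45.RMuForm σ hμ)))))
    (h21 : shimura1998_thm21_4_casselman) :
    Nonempty (toThm418Data C (U.rest (restTailOne (AlgHom.id ℚ (L : Type)) σ hμ hw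
      (Def45.Carriers.ofPolDR μ (Def45.PolDR σ hμ (Def45.RMuForm σ hμ))) rhoΩ))).Obj :=
  (nonempty_obj_rest_restTailOne_iff V Φ (AlgHom.id ℚ (L : Type)) σ hμ hw _ h C U rhoΩ).mpr
    (Def45.nonempty_cmDatum_polDR_rMuForm_of_casselman σ hμ hw h21)

end ObjAlong

/-! ## §3  The pieces (d) with S1 discharged: rest PRESENTED through `ιP`, S1 READ through the instance `ιQ` (`η_μ`-invariance)

The one-object rest of the shared tail is presented through `ιP` (`restOne C (AlgHom.id ℚ L) ιP …`, at the pin `ιP = ι₁`), while the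
J-record complexifies `A_μ` along the instance `algebraMap L ℂ = ιQ` (at the geometric pin `ιQ = ῑ₁`).  [Liu2021] Def. 4.5 (2) does not
depend on the presentation: `Def45.eta φ ιQ hμ = Def45.eta φ ιP hμ` (READING I1-R1; for `ιQ = conj ∘ ιP` this is the tree theorem
✔ `Def45.eta_starRingEnd_comp`, `Liu2021/Def45EtaConjugate.lean`), so the chosen datum `datum (AlgHom.id ℚ L) ιP … M.Dμ` IS a
`Def45.CMDatum (AlgHom.id ℚ L) ιQ …` with the SAME `(A_μ, i_μ)` (the transport is written inline, field by field), and the S1 core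
✔ `exists_liuCMRecord_of_cmDatum ιQ` applies to it: its records are read through `ιQ` (reflex field `K*_{ιQ}`, reflex type through `ιQ`,
`incl_{ιQ}`), i.e. `IsReflexOfTypeG ιQ Φ_μ`-admissible (✔ `admLiu_mk_of_eq ιQ`). -/

section PiecesAt

open Literature.AlgebraicGeometry.ComplexMultiplication
open Literature.NumberTheory.ComplexMultiplication
open Literature.NumberTheory.Automorphic.IdeleClassGroup

variable {hHD : exists_isReal_hodgeModel} {hI : hodgePQ_independent_of_hodgeModel}
  {h₁ : BallQuotientUniformised} {h₃ : CMAbelianVarietyRealised} {hA : Arapura2012_Cor_15_4_6}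
variable {L : HodgeCM.CMField} [IsGalois ℚ (L : Type)] {ι₁ : (L : Type) →+* ℂ} (V : HodgeCM.HermSpace3 L ι₁)
variable (Char : Type) (Adm : Char → Type) (Ω : (i : Char) → Adm i → Type)
  [∀ i a, AddCommGroup (Ω i a)] [∀ i a, Module ℂ (Ω i a)] [∀ i a, Module (adelicAlgebra V) (Ω i a)]
  [∀ i a, IsScalarTower ℂ (adelicAlgebra V) (Ω i a)] (PhiMu : Char → Prop) (adm : Char → LiuCMSide → Prop)
variable (Φ : Literature.AlgebraicGeometry.Motives.CMType L) {isotropicAt : ℕ → Prop}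
-- the PRESENTATION embedding `ιP` of the rest (pin of record: `ι₁`) and the INSTANCE embedding `ιQ` (geometric pin: `ῑ₁ = (starRingEnd ℂ).comp ι₁`)
variable (ιP ιQ : (L : Type) →+* ℂ) [inst : Algebra (L : Type) ℂ]
variable {μ : Literature.NumberTheory.Automorphic.IdeleClassGroup (L : Type) →ₜ* Circle}
  (hμ : Literature.NumberTheory.Automorphic.IdeleClassGroup.IsConjugateSymplectic (L : Type) μ)
  (hw : Literature.NumberTheory.Automorphic.IdeleClassGroup.HasWeight (L : Type) μ 1) (Car : Def45.Carriers (L : Type) μ)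
  (Eps : Type) (epsOf : L → Eps) (Chi : Type) (omega : Eps → Chi → Type)
  [∀ ε χ, AddCommGroup (omega ε χ)] [∀ ε χ, Module ℂ (omega ε χ)]

/-- **Δ2 BRIDGE, PIN (d) with S1 DISCHARGED — rest presented through `ιP`, `A_μ` complexified along the instance `ιQ` (`hinst`), under the
`η_μ`-invariance `heta : eta id ιQ hμ = eta id ιP hμ`.**  The pieces `HcmPieces` at the tower dictionary `LiuDictionary.ofTower …` over the one-object
rest `restOne C (AlgHom.id ℚ L) ιP …`, from the J-junction inputs `rj ∕ hj ∕ jf ∕ hrj` (d2bridge-prove-2 ∕ -5), Liu's eigenclass `(α₀, hα₀, hα₀0)` of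
`H¹(A_μ ⊗_{L,ιQ} ℂ; ℂ)` ([Liu2021] proof of Thm. 4.18 l. 2250), and `hadm`: `adm i` of EVERY model CM record with reflex data
`(↥K*_μ, Ψ*_μ, M_μ, e_μ, M_μ ⊆ ℂ)` READ THROUGH `ιQ` — the binders `dLiu ∕ u ∕ hu` of ✔ `nonempty_hcmPieces_ofTower` being discharged by ✔ `exists_liuCMRecord_of_cmDatum ιQ`
on the datum `datum (AlgHom.id ℚ L) ιP … M.Dμ` transported field by field along `heta` (same `A_μ`, same `i_μ`).  At `ιQ = ιP`, `heta := rfl` this is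
✔ `nonempty_hcmPieces_ofTower_of_cmDatum` (d2bridge-prove-8).  HC_CM is NOT proved; «Δ2 BRIDGE CLOSED» is NOT claimed.
[cite: Liu2021, Def. 4.5 (1)–(2) (FJcycle.tex l. 1939–1951), Def. 4.3 (2) (l. 1919), proof of Thm. 4.18 (l. 2246–2253), Thm. 4.18 (1) (l. 2239), Rem. 4.17, Lem. 2.4 (1)]
[cite: Shimura1998, §7.1 Proposition 7 and §8.3 Prop. 28] -/
theorem nonempty_hcmPieces_ofTower_of_cmDatum_at (h : exists_recordSystem)
    (C : Sec42Data (Model.honestP5Of h ⟨L.K⟩ ι₁ ⟨V.Hm, V.isHermitian, V.signature_ι₁, V.posDef_of_ne⟩ Φ) isotropicAt)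
    (rho : ∀ ε χ, Representation ℂ C.G (omega ε χ))
    (rhoΩ : Representation (fieldOfValues (L : Type) μ) C.G (ΩOne C (AlgHom.id ℚ (L : Type)) ιP hμ hw Car))
    (hinst : ∀ x : (L : Type), algebraMap (L : Type) ℂ x = ιQ x)
    (heta : Def45.eta (AlgHom.id ℚ (L : Type)) ιQ hμ = Def45.eta (AlgHom.id ℚ (L : Type)) ιP hμ)
    (M : (toThm418Data C (restOne C (AlgHom.id ℚ (L : Type)) ιP hμ hw Car Eps epsOf Chi omega rho rhoΩ)).Map43RationalData)
    (Λ : LevelwiseBettiPullback C (AμOne (AlgHom.id ℚ (L : Type)) ιP hμ hw Car M.Dμ) M.L M.U)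
    (hMP : M.P = PΩOne C (AlgHom.id ℚ (L : Type)) ιP hμ hw Car M.Dμ Λ)
    (jH : M.HB →ₗ[ℂ] (LiuDictionary.ofTower hHD hI h₁ h₃ hA V Char Adm Ω PhiMu adm).H)
    (i : Char) (K : HodgeCM.Level V)
    (rj : Λ.AKQ (C.levelOf K.K) →ₗ[ℚ]
      (picardCMUniverse hHD hI h₁ h₃).Coh ((picardCMUniverse hHD hI h₁ h₃).pms L ι₁ V K) 1)
    (hj : ∀ (z : ℂ) (x : Λ.AKQ (C.levelOf K.K)),
      resTotal hHD hI (ballQuotientUniformisedDatum_of h₁) h₃ hA K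
          (jH (M.ι ((Λ.transKQ (C.levelOf K.K)).baseChange ℂ (z ⊗ₜ[ℚ] x)))) = z ⊗ₜ[ℚ] rj x)
    (α₀ : ℂ ⊗[ℚ] bettiCohomology ((AμOne (AlgHom.id ℚ (L : Type)) ιP hμ hw Car M.Dμ).baseChange ℂ).X 1)
    (hα₀ : haveI := hμ.numberField_muAlgValueField
      ∀ k : muAlgValueField (L : Type) μ,
        (hOneAlgHom ((AbelianVariety.endAlgebra.mapRingHom
            ((datum (AlgHom.id ℚ (L : Type)) ιP hμ hw Car M.Dμ).A.endBaseChange ℂ)).toRingHom.comp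
          (datum (AlgHom.id ℚ (L : Type)) ιP hμ hw Car M.Dμ).i) k).baseChange ℂ α₀ =
          ((k : muAlgValueField (L : Type) μ) : ℂ) • α₀)
    (hα₀0 : α₀ ≠ 0)
    (jf : (C.A (C.levelOf K.K) ⟶ AμOne (AlgHom.id ℚ (L : Type)) ιP hμ hw Car M.Dμ) →
        ((pmsRealisation (ballQuotientUniformisedDatum_of h₁) (pmsCode L ι₁ V K)).X ⟶
          ((AμOne (AlgHom.id ℚ (L : Type)) ιP hμ hw Car M.Dμ).baseChange ℂ).X))
    (hrj : ∀ f : C.A (C.levelOf K.K) ⟶ AμOne (AlgHom.id ℚ (L : Type)) ιP hμ hw Car M.Dμ,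
        (rj ∘ₗ Λ.phiStarQ (C.levelOf K.K) f).baseChange ℂ M.α = (pull (jf f) 1).baseChange ℂ α₀)
    (hadm : haveI := hμ.numberField_muAlgValueField
      ∀ (A : AbelianVariety ℂ) (ιA : NumberField.RingOfIntegers ↥(muAlgValueField (L : Type) μ) →+* End A)
        (θA : ↥(muAlgValueField (L : Type) μ) →+* Module.End ℂ (complexBetti A.X 1))
        (hA' : IsCMTypeRealisation (inducedCMType (Def45.incl (AlgHom.id ℚ (L : Type)) ιQ hμ)
          (reflexCMType ιQ hμ.cmType (AlgHom.id ℚ (L : Type)))) A ιA θA)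
        (α : ℂ ⊗[ℚ] bettiCohomology A.X 1)
        (hα : α ∈ eigenline (HodgeCM.CM.CommonReflex.complexify (BettiUniverse.cmAction θA hA'.isInducedOnIntegers))
          (muAlgValueField (L : Type) μ).subtype),
        adm i
          { K' := ↥(reflexField ℚ (L : Type) (algValuedIn ιQ hμ.cmType.1))
            Φ' := (reflexCMType ιQ hμ.cmType (AlgHom.id ℚ (L : Type))).1
            M := ↥(muAlgValueField (L : Type) μ)
            instNumberFieldM := hμ.numberField_muAlgValueField
            k := Def45.incl (AlgHom.id ℚ (L : Type)) ιQ hμ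
            A := A, ιA := ιA, θA := θA
            ΦA := inducedCMType (Def45.incl (AlgHom.id ℚ (L : Type)) ιQ hμ) (reflexCMType ιQ hμ.cmType (AlgHom.id ℚ (L : Type)))
            hΦA := fun θ => mem_inducedCMType_iff _ _ θ
            isRealisation := hA'
            τ := (muAlgValueField (L : Type) μ).subtype
            α := α, α_mem := hα }) :
    Nonempty (HcmPieces.{0, 1, 0} (toThm418Data C (restOne C (AlgHom.id ℚ (L : Type)) ιP hμ hw Car Eps epsOf Chi omega rho rhoΩ)) M
      (LiuDictionary.ofTower hHD hI h₁ h₃ hA V Char Adm Ω PhiMu adm).H jH K.K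
      ((picardCMUniverse hHD hI h₁ h₃).CohC ((picardCMUniverse hHD hI h₁ h₃).pms L ι₁ V K) 1)
      (resTotal hHD hI (ballQuotientUniformisedDatum_of h₁) h₃ hA K)
      ((LiuDictionary.ofTower hHD hI h₁ h₃ hA V Char Adm Ω PhiMu adm).cmClasses K i)) := by
  obtain rfl : inst = ιQ.toAlgebra := Algebra.algebra_ext _ _ hinst
  letI : Algebra (L : Type) ℂ := ιQ.toAlgebra
  haveI := hμ.numberField_muAlgValueField
  -- the chosen Def. 4.5 (2) datum, presented through `ιP`, TRANSPORTED to the presentation `ιQ` along `heta` (same `A_μ`, same `i_μ`)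
  let X : Def45.CMDatum (AlgHom.id ℚ (L : Type)) ιQ hμ hw Car :=
    ⟨(datum (AlgHom.id ℚ (L : Type)) ιP hμ hw Car M.Dμ).A, (datum (AlgHom.id ℚ (L : Type)) ιP hμ hw Car M.Dμ).i,
      (datum (AlgHom.id ℚ (L : Type)) ιP hμ hw Car M.Dμ).finrank_eq,
      fun x N f hN hx => by
        rw [heta]
        exact (datum (AlgHom.id ℚ (L : Type)) ιP hμ hw Car M.Dμ).det45 x N f hN hx,
      (datum (AlgHom.id ℚ (L : Type)) ιP hμ hw Car M.Dμ).isCMCharacter,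
      (datum (AlgHom.id ℚ (L : Type)) ιP hμ hw Car M.Dμ).polDR⟩
  -- S1 core (d2bridge-prove-1, ✔ `exists_liuCMRecord_of_cmDatum`) READ THROUGH `ιQ` on the transported datum
  obtain ⟨B, uB, ιB, θB, hB, α', -, hα', hα'0, huB⟩ := exists_liuCMRecord_of_cmDatum ιQ X α₀ hα₀ hα₀0
  refine nonempty_hcmPieces_ofTower V Char Adm Ω PhiMu adm h Φ C (AlgHom.id ℚ (L : Type)) ιP hμ hw Car Eps epsOf Chi omega rho
    rhoΩ M Λ hMP jH i K rj hj α₀ jf hrj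
    (fun q =>
      { K' := ↥(reflexField ℚ (L : Type) (algValuedIn ιQ hμ.cmType.1))
        Φ' := (reflexCMType ιQ hμ.cmType (AlgHom.id ℚ (L : Type))).1
        M := ↥(muAlgValueField (L : Type) μ)
        instNumberFieldM := hμ.numberField_muAlgValueField
        k := Def45.incl (AlgHom.id ℚ (L : Type)) ιQ hμ
        A := B, ιA := ιB, θA := θB
        ΦA := inducedCMType (Def45.incl (AlgHom.id ℚ (L : Type)) ιQ hμ) (reflexCMType ιQ hμ.cmType (AlgHom.id ℚ (L : Type)))
        hΦA := fun θ => mem_inducedCMType_iff _ _ θ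
        isRealisation := hB
        τ := (muAlgValueField (L : Type) μ).subtype
        α := (q : ℂ) • α', α_mem := Submodule.smul_mem _ _ hα' })
    (fun _ => uB.hom.hom.hom) (fun q Y f => ?_)
    (fun q => hadm B ιB θB hB ((q : ℂ) • α') (Submodule.smul_mem _ _ hα'))
  -- `hu`: `(f ≫ u)^*_ℂ (q • α') = q • f^*_ℂ α₀`
  show (pull (f ≫ uB.hom.hom.hom) 1).baseChange ℂ ((q : ℂ) • α') = (q : ℂ) • (pull f 1).baseChange ℂ α₀
  rw [LinearMap.map_smul]
  exact congrArg (fun v => (q : ℂ) • v) (huB Y f)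

/-- **… with the admissibility input as ONE implication** `∀ d, d.IsReflexOfTypeG ιQ Φ' → adm i d` (`Φ_μ = Φ'`): every record the S1 core
produces through `ιQ` is `IsReflexOfTypeG ιQ Φ'`-admissible (✔ `admLiu_mk_of_eq ιQ`), so a dictionary keyed `adm i := (·).IsReflexOfTypeG ιQ Φ'`
(at the geometric pin: `ιQ = ῑ₁`, ORIENTATION-MEMO §3.3 T-ῑ ∕ realisation (c-S.1)) takes `hadm := fun _ hd => hd`.  HC_CM is NOT proved; «Δ2 BRIDGE CLOSED» is NOT claimed.
[cite: Liu2021, Def. 4.3 (2) (FJcycle.tex l. 1919), Def. 4.5 (1)–(2) (l. 1939–1951), proof of Thm. 4.18 (l. 2246–2253)] [cite: Shimura1998, §8.3 Prop. 28] -/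
theorem nonempty_hcmPieces_ofTower_of_isReflexOfTypeG_at (h : exists_recordSystem)
    (C : Sec42Data (Model.honestP5Of h ⟨L.K⟩ ι₁ ⟨V.Hm, V.isHermitian, V.signature_ι₁, V.posDef_of_ne⟩ Φ) isotropicAt)
    (rho : ∀ ε χ, Representation ℂ C.G (omega ε χ))
    (rhoΩ : Representation (fieldOfValues (L : Type) μ) C.G (ΩOne C (AlgHom.id ℚ (L : Type)) ιP hμ hw Car))
    (hinst : ∀ x : (L : Type), algebraMap (L : Type) ℂ x = ιQ x)
    (heta : Def45.eta (AlgHom.id ℚ (L : Type)) ιQ hμ = Def45.eta (AlgHom.id ℚ (L : Type)) ιP hμ)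
    (M : (toThm418Data C (restOne C (AlgHom.id ℚ (L : Type)) ιP hμ hw Car Eps epsOf Chi omega rho rhoΩ)).Map43RationalData)
    (Λ : LevelwiseBettiPullback C (AμOne (AlgHom.id ℚ (L : Type)) ιP hμ hw Car M.Dμ) M.L M.U)
    (hMP : M.P = PΩOne C (AlgHom.id ℚ (L : Type)) ιP hμ hw Car M.Dμ Λ)
    (jH : M.HB →ₗ[ℂ] (LiuDictionary.ofTower hHD hI h₁ h₃ hA V Char Adm Ω PhiMu adm).H)
    (i : Char) (K : HodgeCM.Level V)
    (rj : Λ.AKQ (C.levelOf K.K) →ₗ[ℚ]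
      (picardCMUniverse hHD hI h₁ h₃).Coh ((picardCMUniverse hHD hI h₁ h₃).pms L ι₁ V K) 1)
    (hj : ∀ (z : ℂ) (x : Λ.AKQ (C.levelOf K.K)),
      resTotal hHD hI (ballQuotientUniformisedDatum_of h₁) h₃ hA K
          (jH (M.ι ((Λ.transKQ (C.levelOf K.K)).baseChange ℂ (z ⊗ₜ[ℚ] x)))) = z ⊗ₜ[ℚ] rj x)
    (α₀ : ℂ ⊗[ℚ] bettiCohomology ((AμOne (AlgHom.id ℚ (L : Type)) ιP hμ hw Car M.Dμ).baseChange ℂ).X 1)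
    (hα₀ : haveI := hμ.numberField_muAlgValueField
      ∀ k : muAlgValueField (L : Type) μ,
        (hOneAlgHom ((AbelianVariety.endAlgebra.mapRingHom
            ((datum (AlgHom.id ℚ (L : Type)) ιP hμ hw Car M.Dμ).A.endBaseChange ℂ)).toRingHom.comp
          (datum (AlgHom.id ℚ (L : Type)) ιP hμ hw Car M.Dμ).i) k).baseChange ℂ α₀ =
          ((k : muAlgValueField (L : Type) μ) : ℂ) • α₀)
    (hα₀0 : α₀ ≠ 0)
    (jf : (C.A (C.levelOf K.K) ⟶ AμOne (AlgHom.id ℚ (L : Type)) ιP hμ hw Car M.Dμ) →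
        ((pmsRealisation (ballQuotientUniformisedDatum_of h₁) (pmsCode L ι₁ V K)).X ⟶
          ((AμOne (AlgHom.id ℚ (L : Type)) ιP hμ hw Car M.Dμ).baseChange ℂ).X))
    (hrj : ∀ f : C.A (C.levelOf K.K) ⟶ AμOne (AlgHom.id ℚ (L : Type)) ιP hμ hw Car M.Dμ,
        (rj ∘ₗ Λ.phiStarQ (C.levelOf K.K) f).baseChange ℂ M.α = (pull (jf f) 1).baseChange ℂ α₀)
    (Φ' : Literature.AlgebraicGeometry.Motives.CMType L) (hΦ' : hμ.cmType = Φ')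
    (hadm : ∀ d : LiuCMSide, d.IsReflexOfTypeG ιQ Φ' → adm i d) :
    Nonempty (HcmPieces.{0, 1, 0} (toThm418Data C (restOne C (AlgHom.id ℚ (L : Type)) ιP hμ hw Car Eps epsOf Chi omega rho rhoΩ)) M
      (LiuDictionary.ofTower hHD hI h₁ h₃ hA V Char Adm Ω PhiMu adm).H jH K.K
      ((picardCMUniverse hHD hI h₁ h₃).CohC ((picardCMUniverse hHD hI h₁ h₃).pms L ι₁ V K) 1)
      (resTotal hHD hI (ballQuotientUniformisedDatum_of h₁) h₃ hA K)
      ((LiuDictionary.ofTower hHD hI h₁ h₃ hA V Char Adm Ω PhiMu adm).cmClasses K i)) :=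
  nonempty_hcmPieces_ofTower_of_cmDatum_at V Char Adm Ω PhiMu adm Φ ιP ιQ hμ hw Car Eps epsOf Chi omega h C rho rhoΩ hinst heta
    M Λ hMP jH i K rj hj α₀ hα₀ hα₀0 jf hrj
    (fun A ιA θA hA' α hα => hadm _ (admLiu_mk_of_eq ιQ hμ A ιA θA hA' α hα Φ' hΦ'))

end PiecesAt

/-! ### §3′  At the rests of record `U.rest (restTailOne (AlgHom.id ℚ L) ιP …)` (the SOCKET's `R i` shape — SAME shared tail —
conclusion re-typed by `rfl`), and the GEOMETRIC-PIN instance `ιQ := (starRingEnd ℂ).comp ιP` with `heta` DISCHARGED by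
✔ `Def45.eta_starRingEnd_comp` -/

section PiecesAtRest

open Literature.AlgebraicGeometry.ComplexMultiplication
open Literature.NumberTheory.ComplexMultiplication
open Literature.NumberTheory.Automorphic.IdeleClassGroup

variable {hHD : exists_isReal_hodgeModel} {hI : hodgePQ_independent_of_hodgeModel}
  {h₁ : BallQuotientUniformised} {h₃ : CMAbelianVarietyRealised} {hA : Arapura2012_Cor_15_4_6}
variable {L : HodgeCM.CMField} [IsGalois ℚ (L : Type)] {ι₁ : (L : Type) →+* ℂ} (V : HodgeCM.HermSpace3 L ι₁)
variable (Char : Type) (Adm : Char → Type) (Ω : (i : Char) → Adm i → Type)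
  [∀ i a, AddCommGroup (Ω i a)] [∀ i a, Module ℂ (Ω i a)] [∀ i a, Module (adelicAlgebra V) (Ω i a)]
  [∀ i a, IsScalarTower ℂ (adelicAlgebra V) (Ω i a)] (PhiMu : Char → Prop) (adm : Char → LiuCMSide → Prop)
variable (Φ : Literature.AlgebraicGeometry.Motives.CMType L) {isotropicAt : ℕ → Prop}
variable (ιP : (L : Type) →+* ℂ) [inst : Algebra (L : Type) ℂ]
variable {μ : Literature.NumberTheory.Automorphic.IdeleClassGroup (L : Type) →ₜ* Circle}
  (hμ : Literature.NumberTheory.Automorphic.IdeleClassGroup.IsConjugateSymplectic (L : Type) μ)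
  (hw : Literature.NumberTheory.Automorphic.IdeleClassGroup.HasWeight (L : Type) μ 1) (Car : Def45.Carriers (L : Type) μ)

set_option maxHeartbeats 1600000 in
-- (one definitional re-typing `toThm418Data C (restOne …) ≡ toThm418Data C (U.rest (restTailOne …))` of a large structure type; no search)
/-- **Δ2 BRIDGE, PIN (d) BY VALUE modulo the J-side junction, at the SHARED `ιP`-presented tail `U.rest (restTailOne (AlgHom.id ℚ L) ιP …)` and the
GEOMETRIC-PIN instance `algebraMap L ℂ = conj ∘ ιP`** — `nonempty_hcmPieces_ofTower_of_isReflexOfTypeG_at` at `ιQ := (starRingEnd ℂ).comp ιP`, the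
`η_μ`-invariance DISCHARGED by ✔ `Def45.eta_starRingEnd_comp`, the conclusion re-typed along ✔ `UniformOmega.toThm418Data_restOne_eq` (`rfl`); binders keep the cheap
`restOne` typing.  The admissibility input is `∀ d, d.IsReflexOfTypeG (conj ∘ ιP) Φ' → adm i d` — the dictionary RE-KEYED at the geometric pin (realisation (c-S.1));
at the LITERAL pin (`adm` keyed `ι₁`) this input is NOT available (ORIENTATION-MEMO §1: such records are `Φ̄'`-admissible through `ιP`).
HC_CM is NOT proved; «Δ2 BRIDGE CLOSED» is NOT claimed; nothing here is a display or a pointer move.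
[cite: Liu2021, Def. 4.5 (1)–(2) (FJcycle.tex l. 1939–1951), proof of Thm. 4.18 (l. 2246–2253), Thm. 4.18 (1), Rem. 4.17, Lem. 2.4 (1), Def. 4.11, Def. 4.16]
[cite: Shimura1998, §7.1 Proposition 7 and §8.3 Prop. 28] -/
theorem nonempty_hcmPieces_ofTower_rest_conj_of_isReflexOfTypeG (h : exists_recordSystem)
    (C : Sec42Data (Model.honestP5Of h ⟨L.K⟩ ι₁ ⟨V.Hm, V.isHermitian, V.signature_ι₁, V.posDef_of_ne⟩ Φ) isotropicAt) (U : UniformOmega C)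
    (rhoΩ : Representation (fieldOfValues (L : Type) μ) C.G (ΩOne C (AlgHom.id ℚ (L : Type)) ιP hμ hw Car))
    (hinst : ∀ x : (L : Type), algebraMap (L : Type) ℂ x = ((starRingEnd ℂ).comp ιP) x)
    (M : (toThm418Data C (restOne C (AlgHom.id ℚ (L : Type)) ιP hμ hw Car U.Eps U.epsOf U.Chi (U.omega μ hμ) (U.rho μ hμ)
      rhoΩ)).Map43RationalData)
    (Λ : LevelwiseBettiPullback C (AμOne (AlgHom.id ℚ (L : Type)) ιP hμ hw Car M.Dμ) M.L M.U)
    (hMP : M.P = PΩOne C (AlgHom.id ℚ (L : Type)) ιP hμ hw Car M.Dμ Λ)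
    (jH : M.HB →ₗ[ℂ] (LiuDictionary.ofTower hHD hI h₁ h₃ hA V Char Adm Ω PhiMu adm).H)
    (i : Char) (K : HodgeCM.Level V)
    (rj : Λ.AKQ (C.levelOf K.K) →ₗ[ℚ]
      (picardCMUniverse hHD hI h₁ h₃).Coh ((picardCMUniverse hHD hI h₁ h₃).pms L ι₁ V K) 1)
    (hj : ∀ (z : ℂ) (x : Λ.AKQ (C.levelOf K.K)),
      resTotal hHD hI (ballQuotientUniformisedDatum_of h₁) h₃ hA K
          (jH (M.ι ((Λ.transKQ (C.levelOf K.K)).baseChange ℂ (z ⊗ₜ[ℚ] x)))) = z ⊗ₜ[ℚ] rj x)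
    (α₀ : ℂ ⊗[ℚ] bettiCohomology ((AμOne (AlgHom.id ℚ (L : Type)) ιP hμ hw Car M.Dμ).baseChange ℂ).X 1)
    (hα₀ : haveI := hμ.numberField_muAlgValueField
      ∀ k : muAlgValueField (L : Type) μ,
        (hOneAlgHom ((AbelianVariety.endAlgebra.mapRingHom
            ((datum (AlgHom.id ℚ (L : Type)) ιP hμ hw Car M.Dμ).A.endBaseChange ℂ)).toRingHom.comp
          (datum (AlgHom.id ℚ (L : Type)) ιP hμ hw Car M.Dμ).i) k).baseChange ℂ α₀ =
          ((k : muAlgValueField (L : Type) μ) : ℂ) • α₀)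
    (hα₀0 : α₀ ≠ 0)
    (jf : (C.A (C.levelOf K.K) ⟶ AμOne (AlgHom.id ℚ (L : Type)) ιP hμ hw Car M.Dμ) →
        ((pmsRealisation (ballQuotientUniformisedDatum_of h₁) (pmsCode L ι₁ V K)).X ⟶
          ((AμOne (AlgHom.id ℚ (L : Type)) ιP hμ hw Car M.Dμ).baseChange ℂ).X))
    (hrj : ∀ f : C.A (C.levelOf K.K) ⟶ AμOne (AlgHom.id ℚ (L : Type)) ιP hμ hw Car M.Dμ,
        (rj ∘ₗ Λ.phiStarQ (C.levelOf K.K) f).baseChange ℂ M.α = (pull (jf f) 1).baseChange ℂ α₀)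
    (Φ' : Literature.AlgebraicGeometry.Motives.CMType L) (hΦ' : hμ.cmType = Φ')
    (hadm : ∀ d : LiuCMSide, d.IsReflexOfTypeG ((starRingEnd ℂ).comp ιP) Φ' → adm i d) :
    Nonempty (HcmPieces.{0, 1, 0}
      (toThm418Data C (U.rest (restTailOne (AlgHom.id ℚ (L : Type)) ιP hμ hw Car rhoΩ)))
      (M : (toThm418Data C (U.rest (restTailOne (AlgHom.id ℚ (L : Type)) ιP hμ hw Car rhoΩ))).Map43RationalData)
      (LiuDictionary.ofTower hHD hI h₁ h₃ hA V Char Adm Ω PhiMu adm).H jH K.K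
      ((picardCMUniverse hHD hI h₁ h₃).CohC ((picardCMUniverse hHD hI h₁ h₃).pms L ι₁ V K) 1)
      (resTotal hHD hI (ballQuotientUniformisedDatum_of h₁) h₃ hA K)
      ((LiuDictionary.ofTower hHD hI h₁ h₃ hA V Char Adm Ω PhiMu adm).cmClasses K i)) :=
  nonempty_hcmPieces_ofTower_of_isReflexOfTypeG_at V Char Adm Ω PhiMu adm Φ ιP ((starRingEnd ℂ).comp ιP) hμ hw Car
    U.Eps U.epsOf U.Chi (U.omega μ hμ) h C (U.rho μ hμ) rhoΩ hinst (Def45.eta_starRingEnd_comp (AlgHom.id ℚ (L : Type)) ιP hμ)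
    M Λ hMP jH i K rj hj α₀ hα₀ hα₀0 jf hrj Φ' hΦ' hadm

end PiecesAtRest

end Summit.HodgeConjecture.CorCM.D2Bridge

end
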